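import Summits.Parity.GeneralizedHardyLittlewood.Theorems.LeeYangFibresCellParityLawSavingEngineDefs
import HarnessLib

/-!
# Route `LeeYangFibres`, crux `CellParityLawSaving` (stmt-Parity-18104), line `superpoly-band-same-atom`:
# vocabulary of VARIANT B — polynomial-rate kernel + Granville–Soundararajan-adjacent atom

Route-posited STATEMENTS (D-0016 `<Route><Crux>…Defs` file; companion of `…SavingDefs` / `…SavingEngineDefs`). NOTHING IS
ASSERTED: every `def … : Prop` is the type of a registered stub of the line or of a hypothesis of one; the two theorems
(`engineGS_of_pieces`, `sectionLevelGSAt_mono`) are pure logic / bookkeeping.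

## Why (lead, cycle 1, 2026-08-17)

Skeleton v3 closes the crux modulo its two research inputs, VARIANT A of the exponent trade-off every coordinatewise line
of this crux must make (card `superpoly-band-same-atom`, §"Transfer"): a SUPER-POLYNOMIAL-rate kernel
(`SuperPolyRoughCellLaw a`, rate `e^{Cu²} e^{-cη^{-a}}` in the level deficit `η`) with the atom at the EH-class level
`N^{1-(log log N)^{-B}}` (`SectionLevelAlong`). This file types VARIANT B (cards `permutation-ghosts-parity-gap` /
`effective-rough-cell-law` "Variant", `ObstructionNotes-ideator2.md` B1): a POLYNOMIAL-rate kernel uniform in the roughness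
(`PolyRoughCellLawUniform`: rate `u^{Cu} η^κ` — the `u`-explicit form of the sister crux's `EffectiveRoughCellLaw`, which
is what Friedlander–Iwaniec-type dissections are expected to give) with the atom at the Granville–Soundararajan-adjacent
level `N^{1-(log N)^{-1/c}} = N·exp(-(log N)^{1-1/c})` for ONE `c ≥ 2` (`SectionLevelGSAt c t`; STRONGER than the EH-class
atom, still below the Friedlander–Granville refuted zone `N/(log N)^B`). The engine's main-term conversion, preparations and
assembly (`stub_mainTermAlong`, `stub_prepAlong`, `stub_assemblyAlong`, all LANDED) are kernel-agnostic: only the kernel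
hypotheses (`HypGS`, deficit `etaGS N c = 2(log N)^{-1/c}`) and the kernel application (`ReduceGS`, saving `κ/(2c)`) change.
With both variants kernel-checked the crux reads: `CellParityLawSaving ⟸ (K_a ∧ A_EH) ∨ (K_poly ∧ A_GS)`.

References: as in `LeeYangFibresCellParityLawSavingEngineDefs` [BombieriAsymptoticSieve1976, BombieriRIMS1977,
FriedlanderIwaniecPisa1978, Ford2004, GreenTao2010, Alladi1982]; A. Granville, K. Soundararajan, *An uncertainty principle
for arithmetic sequences*, Ann. of Math. 165 (2007) [GranvilleSoundararajan2007] for the level scale.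
-/

noncomputable section

open scoped BigOperators Classical
open Finset Filter Literature.NumberTheory.Sieve
open Summit.Parity.GeneralizedHardyLittlewood.Cruxes.CellParityLaw.SectionAnnihilator
open Summit.Parity.GeneralizedHardyLittlewood.Cruxes.AbsoluteUpgrade.DipMarginRateExchange (slowDegree)

namespace Summit.Parity.GeneralizedHardyLittlewood.Cruxes.CellParityLawSaving.SuperPolyBand

/-! ## Variant B research inputs (statements; NOT facts) -/

/-- **The polynomial-rate kernel, uniform in the roughness** (`PolyRoughCellLawUniform`; type of the registered stub
`stub_kernelPoly`): VERBATIM the hypotheses and conclusion of `SuperPolyRoughCellLaw` (hence of the sister's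
`EffectiveRoughCellLaw` plus uniformity in `2 ≤ u ≤ √(log log x)`), with the deficit rate `e^{Cu²}e^{-cη^{-a}}` replaced
by the POLYNOMIAL rate with an explicit roughness prefactor, `u^{Cu} · η^κ`. RESEARCH STATEMENT, not a fact:
Friedlander–Iwaniec (Pisa 1978 §4) give `Λ_(k)`-asymptotics with relative error `O_k(δ^{1/3})` from level `x^{1-δ}` and
Bombieri (RIMS 1977) the qualitative `P_r` law; a polynomial rate for the rough `Ω`-CELL COUNTS with `u^{O(u)}` dependence
is the natural conjecture their dissection suggests, unpublished (the sister crux's kernel `EffectiveRoughCellLaw` is its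
fixed-`u` form). Weaker-in-spirit than `SuperPolyRoughCellLaw a` (Ford's construction does not threaten it).
[FriedlanderIwaniecPisa1978, BombieriRIMS1977, Ford2004] -/
def PolyRoughCellLawUniform : Prop :=
  ∀ (A₁ L' : ℝ), ∃ (κ C : ℝ) (A₂ : ℕ) (x₀ : ℝ), 0 < κ ∧ 0 ≤ C ∧
    ∀ (u : ℕ) (𝒜 : SieveSequence) (x z η Λ w₀ R : ℝ), 2 ≤ u → x₀ ≤ x →
      (u : ℝ) ≤ Real.sqrt (Real.log (Real.log x)) →
      x ^ (1 / ((u : ℝ) + 1)) ≤ z → z ≤ x ^ (1 / (u : ℝ)) →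
      Real.log x ^ (-(1 / 2 : ℝ)) ≤ η → η ≤ 1 / (4 * (u : ℝ)) →
      1 ≤ Λ → Λ ≤ x ^ η → 2 ≤ w₀ → w₀ ≤ x ^ η →
      (∀ q : ℕ, 𝒜.a q ≤ 1) → (∀ q : ℕ, x < (q : ℝ) → 𝒜.a q = 0) →
      (∀ q : ℕ, (q : ℝ) ≤ x / Λ → 𝒜.a q = 0) →
      (∀ y : ℝ, 𝒜.size y = 𝒜.congrSum 1 y) → x ^ (1 - 1 / (4 * (u : ℝ))) ≤ 𝒜.size x →
      (∀ p : ℕ, p.Prime → 𝒜.density p ≤ A₁ / p) → HasIwaniecDimension 𝒜.density 1 L' →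
      (∀ w z' : ℝ, w₀ ≤ w → w ≤ z' → z' ≤ x →
          Real.log z' / Real.log w * (1 - L' / Real.log w) ≤
            ∏ p ∈ (Nat.primesBelow ⌈z'⌉₊).filter (fun p : ℕ => w ≤ (p : ℝ)), (1 - 𝒜.density p)⁻¹) →
      (∀ y : ℝ, y ≤ x →
          ∑ d ∈ (Finset.Icc 1 ⌊x ^ (1 - η)⌋₊).filter Squarefree, |𝒜.remainder d y| ≤ R) →
      ∃ δ : ℝ, 0 ≤ δ ∧ δ ≤ 2 ∧ ∀ m : ℕ, 1 ≤ m →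
        |roughCellSum 𝒜 x z m -
            (1 + (δ - 1) * (-1 : ℝ) ^ m) *
              (roughCellDensity m (Real.log x / Real.log z) / (Real.log x / Real.log z)) *
              (Real.exp Real.eulerMascheroniConstant * 𝒜.densityProduct (primesProdBelow z)) *
                𝒜.size x|
          ≤ C * ((u : ℝ) ^ (C * (u : ℝ)) * η ^ κ + Real.log z ^ (-κ) + Real.log (2 * Λ) / Real.log z) *
                (𝒜.densityProduct (primesProdBelow z) * 𝒜.size x) +
              C * Real.log x ^ A₂ * R

/-- **The Granville–Soundararajan-adjacent atom at exponent `c`** (`SectionLevelGSAt c t`, systems of `t + 1 ≥ 2` forms;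
the registered stub `stub_atomGS` asserts it for SOME `c ≥ 2` and all `t ≥ 1`): the atom along the schedule
`SectionLevelAlong t` VERBATIM except for the LEVEL, which is `N^{1-(log N)^{-1/c}} = N·exp(-(log N)^{1-1/c})` instead of
`N^{1-(log log N)^{-B}}` — Bombieri's `(A₂)` in `ℓ¹` over square-free moduli up to that level for every coordinate section
sequence, saving `(log N)^{-A}` for every `A`, `N₀` uniform over the roughness `2 ≤ u ≤ U(N)`. For every fixed `c` and
`B` this is asymptotically STRONGER than `SectionLevelAlong` (smaller deficit `(log N)^{-1/c} ≪ (log log N)^{-B}`, more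
moduli); larger `c` = lower level = weaker statement (`sectionLevelGSAt_mono`); `c = 2` is the level `N e^{-√log N}` of the
de la Vallée Poussin error term; every member stays below `N/(log N)^B`, the Friedlander–Granville refuted zone. A
CONJECTURE (typed tuple-GEH fragment), not a fact. -/
def SectionLevelGSAt (c t : ℕ) : Prop :=
  ∀ (L A : ℕ), ∃ N₀ : ℕ, ∀ N : ℕ, N₀ ≤ N → ∀ u : ℕ, 2 ≤ u → u ≤ slowDegree N →
    ∀ Ψ : Fin (t + 1) → AffLinForm 1, IsNondegenerateSystem Ψ → affLinSize Ψ N ≤ L →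
    ∀ K : Set (Fin 1 → ℝ), Convex ℝ K → K ⊆ realBox 1 N →
    ∀ i : Fin (t + 1), ∀ j' : Fin t → ℕ, (∀ k, 1 ≤ j' k ∧ j' k ≤ u) →
      ∑ d ∈ (Finset.Icc 1 ⌊(N : ℝ) ^ (1 - 1 / Real.log N ^ (1 / (c : ℝ)))⌋₊).filter Squarefree,
          |(sectionMass Ψ K N u i j' d : ℝ) - sectionDensity Ψ i d * sectionMass Ψ K N u i j' 1|
        ≤ (N : ℝ) / Real.log N ^ A

/-! ## Variant B engine vocabulary -/

/-- The kernel's level deficit in Variant B: `η = 2(log N)^{-1/c}` (twice the atom's deficit, so that the kernel level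
`x^{1-η}`, `x = 2LN`, is below the atom's level `N^{1-η/2}`). -/
def etaGS (N c : ℕ) : ℝ := 2 / Real.log N ^ (1 / (c : ℝ))

/-- **The kernel's hypotheses in Variant B** (`KernelReadyGSAt c t`; conclusion of `HypGS`): `KernelReadySavAt t` VERBATIM
with the deficit `etaOf N B₂` replaced by `etaGS N c` (and no `B₂`). -/
def KernelReadyGSAt (c t : ℕ) : Prop :=
  ∀ (L A : ℕ), ∃ L' : ℝ, ∃ N₀ : ℕ, ∀ N : ℕ, N₀ ≤ N →
    ∀ Ψ : Fin (t + 1) → AffLinForm 1, IsNondegenerateSystem Ψ → affLinSize Ψ N ≤ L →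
    ∀ K : Set (Fin 1 → ℝ), Convex ℝ K → K ⊆ realBox 1 N →
    ∀ i : Fin (t + 1), ∀ j' : Fin t → ℕ, (∀ k, 1 ≤ j' k ∧ j' k ≤ slowDegree N) →
      (∀ p : ℕ, p.Prime → sectionDensity Ψ i p < 1) →
      K ⊆ {v | xOf L N / lamOf N t < (Ψ i).realEval v} →
      (N : ℝ) / Real.log N ^ (t + 2) ≤ sectionMass Ψ K N (slowDegree N) i j' 1 →
      ((slowDegree N : ℝ) ≤ Real.sqrt (Real.log (Real.log (xOf L N))) ∧
        xOf L N ^ (1 / ((slowDegree N : ℝ) + 1)) ≤ zOf N (slowDegree N) ∧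
        zOf N (slowDegree N) ≤ xOf L N ^ (1 / (slowDegree N : ℝ)) ∧
        Real.log (xOf L N) ^ (-(1 / 2 : ℝ)) ≤ etaGS N c ∧ etaGS N c ≤ 1 / (4 * (slowDegree N : ℝ)) ∧
        1 ≤ lamOf N t ∧ lamOf N t ≤ xOf L N ^ etaGS N c ∧ 2 ≤ wOf N ∧ wOf N ≤ xOf L N ^ etaGS N c) ∧
      (∀ q : ℕ, (secSeqB Ψ K N (slowDegree N) i j').a q ≤ 1) ∧
      (∀ q : ℕ, xOf L N < (q : ℝ) → (secSeqB Ψ K N (slowDegree N) i j').a q = 0) ∧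
      (∀ q : ℕ, (q : ℝ) ≤ xOf L N / lamOf N t → (secSeqB Ψ K N (slowDegree N) i j').a q = 0) ∧
      (∀ y : ℝ, (secSeqB Ψ K N (slowDegree N) i j').size y = (secSeqB Ψ K N (slowDegree N) i j').congrSum 1 y) ∧
      xOf L N ^ (1 - 1 / (4 * (slowDegree N : ℝ))) ≤ (secSeqB Ψ K N (slowDegree N) i j').size (xOf L N) ∧
      (∀ p : ℕ, p.Prime → (secSeqB Ψ K N (slowDegree N) i j').density p ≤ ((t : ℝ) + 2) / p) ∧
      HasIwaniecDimension (secSeqB Ψ K N (slowDegree N) i j').density 1 L' ∧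
      (∀ w z' : ℝ, wOf N ≤ w → w ≤ z' → z' ≤ xOf L N →
          Real.log z' / Real.log w * (1 - L' / Real.log w) ≤
            ∏ p ∈ (Nat.primesBelow ⌈z'⌉₊).filter (fun p : ℕ => w ≤ (p : ℝ)),
              (1 - (secSeqB Ψ K N (slowDegree N) i j').density p)⁻¹) ∧
      (∀ y : ℝ, y ≤ xOf L N →
          ∑ d ∈ (Finset.Icc 1 ⌊xOf L N ^ (1 - etaGS N c)⌋₊).filter Squarefree,
            |(secSeqB Ψ K N (slowDegree N) i j').remainder d y| ≤ rOf N A) ∧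
      (∀ m : ℕ, 1 ≤ m →
          roughCellSum (secSeqB Ψ K N (slowDegree N) i j') (xOf L N) (zOf N (slowDegree N)) m =
            cell Ψ K N (slowDegree N) (i.insertNth m j')) ∧
      (secSeqB Ψ K N (slowDegree N) i j').size (xOf L N) = sectionMass Ψ K N (slowDegree N) i j' 1 ∧
      (secSeqB Ψ K N (slowDegree N) i j').densityProduct (primesProdBelow (zOf N (slowDegree N))) =
        ∏ p ∈ Nat.primesBelow ⌈zOf N (slowDegree N)⌉₊, (1 - sectionDensity Ψ i p)

/-- **The kernel hypotheses in Variant B, verified** (`HypGS`; type of the registered stub `stub_hypGS`): as `HypAlong`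
with the Variant-B atom at exponent `c ≥ 2`; the range/level conditions along the schedule are now
`(log 2LN)^{-1/2} ≤ 2(log N)^{-1/c}` (`c ≥ 2`), `2(log N)^{-1/c} ≤ 1/(4U(N))` (`8U(N) ≤ (log N)^{1/c}`, `U ≤ √(log log N)`),
`(log N)^k ≤ (2LN)^{η}` (`(2LN)^η ≥ exp(2(log N)^{1-1/c})`) and the level comparison `⌊(2LN)^{1-2ε}⌋ ≤ ⌊N^{1-ε}⌋`,
`ε = (log N)^{-1/c}` (`log 2L ≤ ε log N = (log N)^{1-1/c}`). -/
def HypGS : Prop :=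
  SectionSeqBFacts → SectionSeqBCells → SectionDimension → SectionDimensionLow →
    ∀ c : ℕ, 2 ≤ c → (∀ t : ℕ, 1 ≤ t → SectionLevelGSAt c t) → ∀ t : ℕ, 1 ≤ t → KernelReadyGSAt c t

/-- **The kernel application in Variant B** (`ReduceGS`; type of the registered stub `stub_reduceGS`): apply
`PolyRoughCellLawUniform` at `(A₁ = t+2, L')` to the ready sequence; with `η = 2(log N)^{-1/c}` the deficit term is
`C U^{CU} 2^κ (log N)^{-κ/c} ≤ ¼(log N)^{-δ}` for `δ = min(κ/(2c), 1)/4` (`U^{CU} = e^{CU log U} ≤ (log N)^{κ/(4c)}` since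
`4U² ≤ log log N`); the other three terms as in `stub_reduceAlong`. -/
def ReduceGS : Prop :=
  PolyRoughCellLawUniform → ∀ c : ℕ, 2 ≤ c → (∀ t : ℕ, 1 ≤ t → KernelReadyGSAt c t) →
    ∀ t : ℕ, 1 ≤ t → RawSectionLawSavAt t

/-- **The Variant-B engine statement** (what `engineGS_of_pieces` composes): the polynomial kernel and the GS atom for
some exponent `c ≥ 2` give the fed section law along the schedule. -/
def EngineGS : Prop :=
  PolyRoughCellLawUniform → (∃ c : ℕ, 2 ≤ c ∧ ∀ t : ℕ, 1 ≤ t → SectionLevelGSAt c t) →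
    ∀ t : ℕ, 1 ≤ t → LawSavAt t → SectionLawSavAt t

/-! ## Pure logic -/

/-- **`engineGS_of_pieces`** (pure logic): the two Variant-B glue stubs and the three kernel-agnostic landed engine
pieces (`MainTermAlong`, `PrepAlong`, `AssemblyAlong`, through their statements) give `EngineGS`. -/
theorem engineGS_of_pieces : SectionSeqBFacts → SectionSeqBCells → SectionDimension → SectionDimensionLow → SectionMertensLowerHead → SingularRatioBound → DensityBoundsAlong → HypGS → ReduceGS → MainTermAlong → PrepAlong → AssemblyAlong → EngineGS := by
  rintro hF hC hD hDl hLH hSing hDens hHyp hRed hMT hPrep hAsm hK ⟨c, hc, hA⟩ t ht hLaw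
  exact hAsm hF hC (hMT hLH) hPrep hSing hDens (hRed hK c hc (hHyp hF hC hD hDl c hc hA)) t ht hLaw

/-- Monotonicity of the Variant-B atom in the exponent: a larger `c` is a lower level, hence a weaker statement
(`1 ≤ c ≤ c'` gives `SectionLevelGSAt c t → SectionLevelGSAt c' t`; the sum over the smaller range of moduli is
dominated term by term). -/
theorem sectionLevelGSAt_mono {c c' t : ℕ} (hc : 1 ≤ c) (hcc' : c ≤ c') (h : SectionLevelGSAt c t) :
    SectionLevelGSAt c' t := by
  intro L A
  obtain ⟨N₀, hN₀⟩ := h L A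
  refine ⟨max N₀ 3, fun N hN u hu huU Ψ hΨ hL K hK hKN i j' hj' => ?_⟩
  have hN₀N : N₀ ≤ N := le_trans (le_max_left _ _) hN
  have hN3 : (3 : ℝ) ≤ N := by exact_mod_cast le_trans (le_max_right _ _) hN
  have hmain := hN₀ N hN₀N u hu huU Ψ hΨ hL K hK hKN i j' hj'
  refine le_trans (Finset.sum_le_sum_of_subset_of_nonneg ?_ fun _ _ _ => abs_nonneg _) hmain
  intro d hd
  obtain ⟨hdI, hdsq⟩ := Finset.mem_filter.mp hd
  obtain ⟨hd1, hdle⟩ := Finset.mem_Icc.mp hdI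
  refine Finset.mem_filter.mpr ⟨Finset.mem_Icc.mpr ⟨hd1, hdle.trans (Nat.floor_le_floor ?_)⟩, hdsq⟩
  -- `N^{1 - ℓ^{-1/c'}} ≤ N^{1 - ℓ^{-1/c}}` since `ℓ^{1/c'} ≤ ℓ^{1/c}` for `ℓ ≥ 1`, `c ≤ c'`
  have hN1 : (1 : ℝ) ≤ N := by linarith
  have hlog1 : 1 ≤ Real.log (N : ℝ) := by
    rw [Real.le_log_iff_exp_le (by linarith)]
    exact le_trans (le_of_lt Real.exp_one_lt_d9) (by linarith)
  have hc0 : (0 : ℝ) < c := by exact_mod_cast hc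
  have hc'0 : (0 : ℝ) < c' := by exact_mod_cast (lt_of_lt_of_le hc hcc')
  have hexp : 1 / (c' : ℝ) ≤ 1 / (c : ℝ) := one_div_le_one_div_of_le hc0 (by exact_mod_cast hcc')
  have hpow : Real.log (N : ℝ) ^ (1 / (c' : ℝ)) ≤ Real.log (N : ℝ) ^ (1 / (c : ℝ)) :=
    Real.rpow_le_rpow_of_exponent_le hlog1 hexp
  have hpos : 0 < Real.log (N : ℝ) ^ (1 / (c' : ℝ)) := Real.rpow_pos_of_pos (by linarith) _
  refine Real.rpow_le_rpow_of_exponent_le hN1 ?_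
  have := one_div_le_one_div_of_le hpos hpow
  linarith

end Summit.Parity.GeneralizedHardyLittlewood.Cruxes.CellParityLawSaving.SuperPolyBand

end
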